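import Summits.PneNP.PneNP.Theorems.SymmetryBudgetWindowCanoniserWiringMainDefs

/-!
# Window canoniser, V: levels of gates (definitions and the bookkeeping lemmas)

Route `PneNP/SymmetryBudget`, dichotomy `WindowBarrier` (stmt-PneNP-2145) / `NoHiddenOrder` (stmt-PneNP-14781);
continuation of `…WindowCanoniserWiringMainDefs.lean`.  Acyclicity of the wiring is witnessed by a LEVEL:
every atom has an atom level `WCan.Atom.al` — shared atoms below `SH n`; the atoms of label `L` in the block
`[SH + M(L)·BLK, SH + (M(L)+1)·BLK)`, inside which replay iteration `it` occupies `[it·RS, (it+1)·RS)` and the main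
computation the top `MS` levels — and a gate has level `4·(atom level bound) + (0,1,2,3)` for atom / negated atom /
width-8 / width-4 formula (`WCan.Node.level`).  Here: these definitions and the combinator lemmas (`WCan.OK`) by
which `…LevelsReplay.lean` / `…LevelsMain.lean` show that every wire of every gate points to a gate of smaller
level.
-/

-- `Summit.PneNP.PneNP.…` duplicates `PneNP` BY DESIGN (single-problem summit, D-0017 layout).
set_option linter.dupNamespace false

noncomputable section

namespace Summit.PneNP.PneNP.Theorems

namespace WCan

open Finset Equiv Literature.Computability.Complexity

variable {K r n : ℕ}

/-! ### Level constants -/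

/-- Strict bound on the levels of shared atoms. -/
def SH (n : ℕ) : ℕ := 4 * n + 5
/-- Span of one replay iteration. -/
def RS (n : ℕ) : ℕ := 4 * n + 8
/-- Span of the main computation. -/
def MS : ℕ := 12
/-- Span of a label block. -/
def BLK (n : ℕ) : ℕ := (T n + 1) * RS n + MS

/-- Level of a shared atom. -/
def SKind.al (n : ℕ) (P : Prm r n) : SKind → ℕ
  | .exV => 0 | .exO => 1
  | .rLT => 1 + 4 * P.rd | .rcge => 2 + 4 * P.rd | .rallb => 3 + 4 * P.rd | .rlex => 4 + 4 * P.rd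

/-- Local level of a labelled atom inside its label block. -/
def Kind.loc (n : ℕ) (P : Prm r n) : Kind → ℕ
  | .sW => P.it * RS n | .sLT => P.it * RS n | .sC => P.it * RS n | .sARR => P.it * RS n | .sDEAD => P.it * RS n
  | .now => P.it * RS n + 1 | .cnt1 => P.it * RS n + 1 | .frz => P.it * RS n + 2 | .sw => P.it * RS n + 1
  | .reach => P.it * RS n + 2 + P.rd | .conn => P.it * RS n + (n + 3)
  | .szGE => P.it * RS n + 1 | .big => P.it * RS n + 1 | .bmc => P.it * RS n + 2 | .sel => P.it * RS n + 3
  | .hasSel => P.it * RS n + 4 | .pok => P.it * RS n + (n + 3) | .nWs => P.it * RS n + (n + 3)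
  | .fLT => P.it * RS n + (4 + 4 * P.rd) | .fcge => P.it * RS n + (5 + 4 * P.rd)
  | .fallb => P.it * RS n + (6 + 4 * P.rd) | .flex => P.it * RS n + (7 + 4 * P.rd)
  | .rkGE => (T n + 1) * RS n | .mtch => (T n + 1) * RS n | .thru => (T n + 1) * RS n + 1
  | .cert => (T n + 1) * RS n + 2 | .pcand => (T n + 1) * RS n | .lcrk => (T n + 1) * RS n + 1
  | .pfx => (T n + 1) * RS n + 2 | .lexLE => (T n + 1) * RS n + 3 | .best => (T n + 1) * RS n + 4
  | .ivbit => (T n + 1) * RS n + 5 | .inonbot => (T n + 1) * RS n + 3 | .isP => (T n + 1) * RS n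
  | .pcov => (T n + 1) * RS n + 3 | .pnonbot => (T n + 1) * RS n + 4 | .pbit => (T n + 1) * RS n + 1
  | .rkInGE => (T n + 1) * RS n | .pcP => (T n + 1) * RS n + 1 | .ppc => (T n + 1) * RS n + 2
  | .pcrk => (T n + 1) * RS n + 3 | .ppfx => (T n + 1) * RS n + 4 | .plexLT => (T n + 1) * RS n + 5
  | .pstGE => (T n + 1) * RS n + 6 | .pbcGE => (T n + 1) * RS n + 5 | .pat => (T n + 1) * RS n + 7
  | .off => (T n + 1) * RS n + 8 | .blkI => (T n + 1) * RS n + 8 | .samePart => (T n + 1) * RS n + 9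
  | .spc => (T n + 1) * RS n + 9 | .svadj => (T n + 1) * RS n + 10 | .svext => (T n + 1) * RS n + 9
  | .svcrk => (T n + 1) * RS n + 10 | .vbit => (T n + 1) * RS n + 11

/-- A strict bound on the measure of every label. -/
def MM (n : ℕ) : ℕ := n * (n + 1) + n + 1

/-- **Atom levels** (constants `0`, outputs above every label). -/
def Atom.al : Atom K r n → ℕ
  | .tt => 0
  | .ff => 0
  | .oo _ _ => 0
  | .outv _ => SH n + MM n * BLK n
  | .sh k P => k.al n P
  | .lab L k P => SH n + L.1.M * BLK n + k.loc n P

/-- The atom-level bound of a gate: its atom, or the largest atom level of its formula. -/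
def Node.abnd : Node K r n → ℕ
  | .atom a => a.al
  | .natom a => a.al
  | .f1 f => univ.sup fun i => (f.ls i).1.al
  | .f2 f => univ.sup fun i => univ.sup fun j => ((f.xs i).ls j).1.al

/-- **Gate levels**: `4·(atom-level bound) + 0/1/2/3`. -/
def Node.level : Node K r n → ℕ
  | .atom a => 4 * a.al
  | .natom a => 4 * a.al + 1
  | .f1 f => 4 * (univ.sup fun i => (f.ls i).1.al) + 2
  | .f2 f => 4 * (univ.sup fun i => univ.sup fun j => ((f.xs i).ls j).1.al) + 3

/-- The level of a gate is controlled by its atom-level bound. -/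
theorem Node.level_le (m : Node K r n) : m.level ≤ 4 * m.abnd + 3 := by
  cases m <;> simp [Node.level, Node.abnd]

/-- The level of a gate is at least four times its atom-level bound. -/
theorem Node.le_level (m : Node K r n) : 4 * m.abnd ≤ m.level := by
  cases m <;> simp [Node.level, Node.abnd]

/-! ### Level arithmetic -/

/-- Shared levels are below `SH`. -/
theorem SKind.al_lt (k : SKind) (P : Prm r n) : k.al n P < SH n := by
  have := P.rd.2
  cases k <;> simp [SKind.al, SH] <;> omega

/-- Local levels are below `BLK`. -/
theorem Kind.loc_lt (k : Kind) (P : Prm r n) : k.loc n P < BLK n := by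
  have h1 := P.it.2
  have h2 := P.rd.2
  have hRS : 7 + 4 * n < RS n := by simp [RS]; omega
  have hit : (P.it : ℕ) * RS n ≤ T n * RS n := Nat.mul_le_mul_right _ (by omega)
  have hT : T n * RS n + RS n = (T n + 1) * RS n := by ring
  cases k <;> simp only [Kind.loc, BLK, MS] <;> nlinarith

/-- A shared atom is below every labelled atom. -/
theorem Atom.al_sh_lt_lab (k : SKind) (P : Prm r n) (L : Lab K n) (k' : Kind) (P' : Prm r n) :
    (Atom.sh k P : Atom K r n).al < (Atom.lab L k' P').al := by
  have := SKind.al_lt k P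
  simp only [Atom.al]; omega

/-- **A label of smaller measure is entirely below.** -/
theorem Atom.al_lt_of_M_lt {L L' : Lab K n} (h : L'.1.M < L.1.M) (k k' : Kind) (P P' : Prm r n) :
    (Atom.lab L' k' P' : Atom K r n).al < (Atom.lab L k P).al := by
  have h1 := Kind.loc_lt k' P' (r := r)
  simp only [Atom.al]
  have : L'.1.M * BLK n + BLK n ≤ L.1.M * BLK n := by
    have := Nat.mul_le_mul_right (BLK n) h
    rwa [Nat.succ_mul] at this
  omega

/-- Inside one label: comparison of local levels. -/
theorem Atom.al_lab_lt_lab (L : Lab K n) {k k' : Kind} {P P' : Prm r n} (h : k'.loc n P' < k.loc n P) :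
    (Atom.lab L k' P' : Atom K r n).al < (Atom.lab L k P).al := by
  simp only [Atom.al]; omega

/-! ### The `OK` predicate and its combinators -/

/-- `OK c w`: if the wire `w` is a gate, its atom-level bound is below `c`. -/
def OK (c : ℕ) (w : Wire K r n) : Prop := ∀ m, w = Sum.inr m → m.abnd < c

/-- `ok_inl`: bookkeeping/simp lemma (ok inl). -/
theorem ok_inl {c : ℕ} (q : Fin (r + n) × Fin (r + n)) : OK c (Sum.inl q : Wire K r n) := fun _ h => by cases h

/-- `ok_wA`: bookkeeping/simp lemma (ok wA). -/
theorem ok_wA {c : ℕ} {b : Atom K r n} (h : b.al < c) : OK c (wA b) := fun m hm => by cases hm; exact h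

/-- `ok_wN`: bookkeeping/simp lemma (ok wN). -/
theorem ok_wN {c : ℕ} {b : Atom K r n} (h : b.al < c) : OK c (wN b) := fun m hm => by cases hm; exact h

/-- `abnd_f1_lt`: bookkeeping/simp lemma (abnd f1 lt). -/
theorem abnd_f1_lt {c : ℕ} {f : N1 K r n} (h : ∀ i, (f.ls i).1.al < c) (hc : 0 < c) : (Node.f1 f).abnd < c := by
  simp only [Node.abnd]
  exact (Finset.sup_lt_iff hc).2 fun i _ => h i

/-- `ok_w1`: bookkeeping/simp lemma (ok w1). -/
theorem ok_w1 {c : ℕ} {f : N1 K r n} (h : ∀ i, (f.ls i).1.al < c) (hc : 0 < c) : OK c (w1 f) :=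
  fun m hm => by cases hm; exact abnd_f1_lt h hc

/-- `ok_w2`: bookkeeping/simp lemma (ok w2). -/
theorem ok_w2 {c : ℕ} {f : N2 K r n} (h : ∀ i j, ((f.xs i).ls j).1.al < c) (hc : 0 < c) : OK c (w2 f) :=
  fun m hm => by
    cases hm
    simp only [Node.abnd]
    exact (Finset.sup_lt_iff hc).2 fun i _ => (Finset.sup_lt_iff hc).2 fun j _ => h i j

/-- `ok_append`: bookkeeping/simp lemma (ok append). -/
theorem ok_append {c N M : ℕ} {f : Fin N → Wire K r n} {g : Fin M → Wire K r n} (hf : ∀ i, OK c (f i))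
    (hg : ∀ j, OK c (g j)) (k : Fin (N + M)) : OK c (Fin.append f g k) := by
  induction k using Fin.addCases with
  | left i => rw [Fin.append_left]; exact hf i
  | right j => rw [Fin.append_right]; exact hg j

/-- `ok_ite`: bookkeeping/simp lemma (ok ite). -/
theorem ok_ite {c : ℕ} {p : Prop} [Decidable p] {w₁ w₂ : Wire K r n} (h₁ : OK c w₁) (h₂ : OK c w₂) :
    OK c (if p then w₁ else w₂) := by
  split_ifs
  · exact h₁
  · exact h₂

/-- `ok_dite`: bookkeeping/simp lemma (ok dite). -/
theorem ok_dite {c : ℕ} {p : Prop} [Decidable p] {w₁ : p → Wire K r n} {w₂ : ¬p → Wire K r n}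
    (h₁ : ∀ h, OK c (w₁ h)) (h₂ : ∀ h, OK c (w₂ h)) : OK c (if h : p then w₁ h else w₂ h) := by
  split_ifs with h
  · exact h₁ h
  · exact h₂ h

/-- `tt` has level `0`. -/
@[simp] theorem al_ttA : (ttA : Atom K r n).al = 0 := rfl
/-- `ff` has level `0`. -/
@[simp] theorem al_ffA : (ffA : Atom K r n).al = 0 := rfl

/-- Literals of a padded conjunction: listed or `tt`. -/
theorem ls_n1and (ls : List (Lit K r n)) (i : Fin 8) : (n1and ls).ls i ∈ ls ∨ (n1and ls).ls i = pos ttA := by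
  simp only [n1and, List.getD_eq_getElem?_getD]
  cases h : ls[(i : ℕ)]? with
  | none => exact Or.inr rfl
  | some l => exact Or.inl (List.mem_of_getElem? h)

/-- Literals of a padded disjunction: listed or `ff`. -/
theorem ls_n1or (ls : List (Lit K r n)) (i : Fin 8) : (n1or ls).ls i ∈ ls ∨ (n1or ls).ls i = pos ffA := by
  simp only [n1or, List.getD_eq_getElem?_getD]
  cases h : ls[(i : ℕ)]? with
  | none => exact Or.inr rfl
  | some l => exact Or.inl (List.mem_of_getElem? h)

/-- `al_n1and_lt`: bookkeeping/simp lemma (al n1and lt). -/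
theorem al_n1and_lt {c : ℕ} {ls : List (Lit K r n)} (h : ∀ l ∈ ls, l.1.al < c) (hc : 0 < c) (i : Fin 8) :
    ((n1and ls).ls i).1.al < c := by
  rcases ls_n1and ls i with h' | h'
  · exact h _ h'
  · rw [h']; exact hc

/-- `al_n1or_lt`: bookkeeping/simp lemma (al n1or lt). -/
theorem al_n1or_lt {c : ℕ} {ls : List (Lit K r n)} (h : ∀ l ∈ ls, l.1.al < c) (hc : 0 < c) (i : Fin 8) :
    ((n1or ls).ls i).1.al < c := by
  rcases ls_n1or ls i with h' | h'
  · exact h _ h'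
  · rw [h']; exact hc

/-- `ok_w1_n1and`: bookkeeping/simp lemma (ok w1 n1and). -/
theorem ok_w1_n1and {c : ℕ} {ls : List (Lit K r n)} (h : ∀ l ∈ ls, l.1.al < c) (hc : 0 < c) : OK c (w1 (n1and ls)) :=
  ok_w1 (al_n1and_lt h hc) hc

/-- `ok_w1_n1or`: bookkeeping/simp lemma (ok w1 n1or). -/
theorem ok_w1_n1or {c : ℕ} {ls : List (Lit K r n)} (h : ∀ l ∈ ls, l.1.al < c) (hc : 0 < c) : OK c (w1 (n1or ls)) :=
  ok_w1 (al_n1or_lt h hc) hc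

/-- Operands of a padded width-4 conjunction: listed or the true formula. -/
theorem xs_n2and (xs : List (N1 K r n)) (i : Fin 4) : (n2and xs).xs i ∈ xs ∨ (n2and xs).xs i = n1and [] := by
  simp only [n2and, List.getD_eq_getElem?_getD]
  cases h : xs[(i : ℕ)]? with
  | none => exact Or.inr rfl
  | some l => exact Or.inl (List.mem_of_getElem? h)

/-- Operands of a padded width-4 disjunction: listed or the false formula. -/
theorem xs_n2or (xs : List (N1 K r n)) (i : Fin 4) : (n2or xs).xs i ∈ xs ∨ (n2or xs).xs i = n1or [] := by
  simp only [n2or, List.getD_eq_getElem?_getD]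
  cases h : xs[(i : ℕ)]? with
  | none => exact Or.inr rfl
  | some l => exact Or.inl (List.mem_of_getElem? h)

/-- The level test for a width-8 formula: all its literals. -/
def N1ok (c : ℕ) (f : N1 K r n) : Prop := ∀ j, (f.ls j).1.al < c

/-- `n1ok_n1and`: bookkeeping/simp lemma (n1ok n1and). -/
theorem n1ok_n1and {c : ℕ} {ls : List (Lit K r n)} (h : ∀ l ∈ ls, l.1.al < c) (hc : 0 < c) : N1ok c (n1and ls) :=
  al_n1and_lt h hc

/-- `n1ok_n1or`: bookkeeping/simp lemma (n1ok n1or). -/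
theorem n1ok_n1or {c : ℕ} {ls : List (Lit K r n)} (h : ∀ l ∈ ls, l.1.al < c) (hc : 0 < c) : N1ok c (n1or ls) :=
  al_n1or_lt h hc

/-- `n1ok_litN1`: bookkeeping/simp lemma (n1ok litN1). -/
theorem n1ok_litN1 {c : ℕ} {l : Lit K r n} (h : l.1.al < c) (hc : 0 < c) : N1ok c (litN1 l) :=
  n1ok_n1and (by simpa using h) hc

/-- `ok_w2_n2and`: bookkeeping/simp lemma (ok w2 n2and). -/
theorem ok_w2_n2and {c : ℕ} {xs : List (N1 K r n)} (h : ∀ f ∈ xs, N1ok c f) (hc : 0 < c) : OK c (w2 (n2and xs)) := by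
  refine ok_w2 (fun i j => ?_) hc
  rcases xs_n2and xs i with h' | h'
  · exact h _ h' j
  · rw [h']; exact al_n1and_lt (by simp) hc j

/-- `ok_w2_n2or`: bookkeeping/simp lemma (ok w2 n2or). -/
theorem ok_w2_n2or {c : ℕ} {xs : List (N1 K r n)} (h : ∀ f ∈ xs, N1ok c f) (hc : 0 < c) : OK c (w2 (n2or xs)) := by
  refine ok_w2 (fun i j => ?_) hc
  rcases xs_n2or xs i with h' | h'
  · exact h _ h' j
  · rw [h']; exact al_n1or_lt (by simp) hc j

/-- `ok_w2_iffF`: bookkeeping/simp lemma (ok w2 iffF). -/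
theorem ok_w2_iffF {c : ℕ} {a b : Atom K r n} (ha : a.al < c) (hb : b.al < c) (hc : 0 < c) : OK c (w2 (iffF a b)) :=
  ok_w2_n2or (by
    intro f hf
    simp only [List.mem_cons, List.not_mem_nil, or_false] at hf
    rcases hf with rfl | rfl <;> exact n1ok_n1and (by simp [ha, hb]) hc) hc

/-- `ok_cnt`: bookkeeping/simp lemma (ok cnt). -/
theorem ok_cnt {c N θ : ℕ} {ws : Fin N → Wire K r n} (h : ∀ i, OK c (ws i)) (hc : 0 < c) (k : Fin (N + N)) :
    OK c (cnt N θ ws k) := by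
  refine ok_append h (fun j => ?_) k
  split_ifs
  · exact ok_wA (by simp [hc])
  · exact ok_wA (by simp [hc])

/-- Level of the adjacency literal's atom: `0`. -/
theorem al_adjLit [NeZero n] (u v : Fin n) : (adjLit (K := K) (r := r) u v).1.al = 0 := by
  unfold adjLit; split_ifs <;> rfl

/-- Level of the negated adjacency literal's atom: `0`. -/
theorem al_nadjLit [NeZero n] (u v : Fin n) : (nadjLit (K := K) (r := r) u v).1.al = 0 := by
  unfold nadjLit; split_ifs <;> rfl

end WCan

end Summit.PneNP.PneNP.Theorems

end
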